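import Summits.QuantumFields.YangMills.Theorems.DiagonalMirrorRPRWilsonDiagonalModelPinned

/-!
# Crux `WeakCouplingHypercubicLimitRP` (stmt-QuantumFields-27398) / aside `DiagonalMirrorRPR` (stmt-QuantumFields-10604), door B:
# the letter R1 `OddTwistGap` READ ON THE PINNED MODEL is a statement about the eigenvalues of the transfer operator

Helper file (`--supports stmt-QuantumFields-27398 --as helper`) of the hand `hand-10604-wilsonDiagModel-2` g2 (director-ym O4 WORD 30 (b): "type the
letter targets instantiated at the diagonal slicing, so that the ideation seats and hands aim at fixed shapes").

* ★ `oddTwistGap_transferModel_iff` — `OddTwistGap (wilsonDiagonalTransferModel r sch hβ)` holds IFF there is `γ > 0` such that, eventually in `k`,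
  EVERY NEGATIVE EIGENVALUE `κᵢ` of the eigen-package `slicePkgAt r sch hβ k` (hand-1's compact self-adjoint realisation `𝔄_k` of the two-step diagonal
  transfer matrix of Wilson's measure on the own odd torus of side `2L_k+1`, reweighted lifted kernel `𝔟` on `L²(μ̃)`) satisfies
  `-κᵢ ≤ exp(-γ a_k) · top_k`, `top_k` the top modulus — the "sign gap of the wrong-sign sector" as a bare spectral inequality, with no padding,
  no `ℕ`-indexing and no interface vocabulary left.

HONEST FRAMING: a restatement (iff) of an OPEN letter on the landed model; nothing is proved about Wilson's spectrum; D1′, ⟨27398⟩, S6i, ⟨10604⟩ OPEN;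
the Yang–Mills mass gap is NOT proved here or anywhere in the tree.  No definition, no instance, no notation, `autoImplicit false`.

References: K. Osterwalder, E. Seiler, Ann. Phys. 110 (1978) §2–3; T. Kanazawa, arXiv:0808.3442 Lemma 2 (sign structure of twisted transfer matrices).
-/

set_option autoImplicit false

noncomputable section

open scoped BigOperators
open MeasureTheory Function Filter Topology
open Literature.MathematicalPhysics.QuantumLattice Literature.MathematicalPhysics.QuantumFieldTheory
open Summit.QuantumFields.YangMills.Cruxes.DiagonalMirrorRPR.ParityBridgeColdTraces

namespace Summit.QuantumFields.YangMills.Cruxes.DiagonalMirrorRPR.SignTwistedDiagonalTrace.WilsonDiagonal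

section Letters

variable {G : Type} [Group G] [TopologicalSpace G] [IsTopologicalGroup G] [CompactSpace G] [MeasurableSpace G] [BorelSpace G]
  (r : LatticeRep G) (sch : SpeciesScheme (YMSpecies G))

/-- Padded negative parts below a non-negative threshold: `(∀ j, negPad emb κ j ≤ c) ↔ ∀ i, κ i < 0 → -κ i ≤ c` (`0 ≤ c`, `emb` injective). -/
theorem negPad_le_iff {ι : Type} {emb : ι → ℕ} (he : Function.Injective emb) (κ : ι → ℝ) {c : ℝ} (hc : 0 ≤ c) :
    (∀ j, negPad emb κ j ≤ c) ↔ ∀ i, κ i < 0 → -κ i ≤ c := by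
  constructor
  · intro h i _
    have hj := h (emb i)
    rw [negPad, he.extend_apply] at hj
    exact (le_max_left _ _).trans hj
  · intro h j
    rw [negPad]
    by_cases hj : ∃ i, emb i = j
    · obtain ⟨i, rfl⟩ := hj
      rw [he.extend_apply]
      refine max_le ?_ hc
      by_cases hi : κ i < 0
      · exact h i hi
      · push Not at hi; linarith
    · rw [Function.extend_apply' _ _ _ hj, Pi.zero_apply]; exact hc

/-- ★ **R1 on the pinned model = a sign gap of the transfer operator's spectrum.**  `OddTwistGap (wilsonDiagonalTransferModel r sch hβ)` holds iff
for some `γ > 0`, eventually in `k`, every negative eigenvalue `κᵢ` of the eigen-package at `k` obeys `-κᵢ ≤ exp(-γ a_k) · top_k`. -/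
theorem oddTwistGap_transferModel_iff (hβ : ∀ k, 0 ≤ sch.β k) :
    OddTwistGap (wilsonDiagonalTransferModel r sch hβ) ↔
      ∃ γ : ℝ, 0 < γ ∧ ∀ᶠ k in atTop, ∀ i : (slicePkgAt r sch hβ k).s, (slicePkgAt r sch hβ k).κ i < 0 →
        -(slicePkgAt r sch hβ k).κ i ≤ Real.exp (-(γ * sch.a k)) * (wilsonDiagonalTransferModel r sch hβ).top k := by
  have h3 := eventually_three_le_side sch
  have hkey : ∀ (γ : ℝ) (k : ℕ), 3 ≤ sch.side k →
      ((∀ j, (wilsonDiagonalTransferModel r sch hβ).sm k j ≤ Real.exp (-(γ * sch.a k)) * (wilsonDiagonalTransferModel r sch hβ).top k) ↔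
        ∀ i : (slicePkgAt r sch hβ k).s, (slicePkgAt r sch hβ k).κ i < 0 →
          -(slicePkgAt r sch hβ k).κ i ≤ Real.exp (-(γ * sch.a k)) * (wilsonDiagonalTransferModel r sch hβ).top k) := by
    intro γ k hk
    rw [wilsonDiagonalTransferModel_sm r sch hβ k hk]
    exact negPad_le_iff (slicePkgAt r sch hβ k).emb_injective _
      (mul_nonneg (Real.exp_pos _).le ((wilsonDiagonalTransferModel r sch hβ).top_pos k).le)
  unfold OddTwistGap
  constructor
  · rintro ⟨γ, hγ, hev⟩
    refine ⟨γ, hγ, ?_⟩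
    filter_upwards [hev, h3] with k hk hk3
    exact (hkey γ k hk3).1 hk
  · rintro ⟨γ, hγ, hev⟩
    refine ⟨γ, hγ, ?_⟩
    filter_upwards [hev, h3] with k hk hk3
    exact (hkey γ k hk3).2 hk

end Letters

end Summit.QuantumFields.YangMills.Cruxes.DiagonalMirrorRPR.SignTwistedDiagonalTrace.WilsonDiagonal

end
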